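import Summits.AtomisticToContinuum.Crystallization.Theses.PalmUnimodularRigidity

/-!
# Route PalmUnimodularRigidity — item 9232 `Assembly`

Item `stmt-AtomisticToContinuum-9232` (assembly, rank 1) of route
`route-AtomisticToContinuum-PalmUnimodularRigidity`:

`MinimiserShells → ShellsToBarlowChart → LayeredLawsSelectHcp → CruxesToPalmRigidity →
 BenjaminiSchrammLimit → PalmToHinge → ChargedPatternCrystallizes → CrysEnergyLimit →
 CrysPeriodicBddBelow → Crystallization` (conclusion: the sub-problem decl `_root_.Crystallization`,
an `abbrev` for `Literature.MathematicalPhysics.StatisticalMechanics.Crystallization`).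

PROOF (pure bookkeeping over the nine items plus two PROVED Literature facts; it is the same
script as the route file's planner-authored deciding theorem `…Theses.PalmUnimodularRigidity.closes`,
repeated here so that this file depends only on the item decls, not on that theorem):

* the three cruxes and the glue `CruxesToPalmRigidity` give the target `PalmRigidity`;
* conjunct (ii) `IsCrystallizing lennardJones 3` is
  `ChargedPatternCrystallizes (PalmToHinge PalmRigidity BenjaminiSchrammLimit CrysEnergyLimit)
   LennardJonesMinimalDistance_holds`;
* conjunct (i) `HasPeriodicGroundStateEnergy lennardJones 3`: a sequence of ground states exists
  (`LennardJonesGroundStatesExist_holds`); `BenjaminiSchrammLimit` gives `φ, δ, P` with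
  `E(φ j)/φ j → E_P[h]`; `CrysEnergyLimit` along `φ` and `tendsto_nhds_unique` force `E_P[h] = e*`,
  so `P` is minimising and `PalmRigidity` makes `P`-a.e. configuration a rotated relaxed HCP crystal
  with `e(hcp a h) = e* = ⨅_Q e(Q)`; since `P` is a probability measure one such `(a, h)` exists,
  `CrysPeriodicBddBelow` + `ciInf_le` give `IsLeast`, and `CrysEnergyLimit` is the convergence.
-/

namespace Summit.AtomisticToContinuum.Crystallization.Theorems

open Filter Topology MeasureTheory

/-- **Item 9232 `Assembly`** (route `PalmUnimodularRigidity`, by name): the nine load-bearing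
items `MinimiserShells`, `ShellsToBarlowChart`, `LayeredLawsSelectHcp`, `CruxesToPalmRigidity`,
`BenjaminiSchrammLimit`, `PalmToHinge`, `ChargedPatternCrystallizes`, `CrysEnergyLimit`,
`CrysPeriodicBddBelow` imply the sub-problem `Crystallization`.  Logic over the items plus the
proved facts `LennardJonesGroundStatesExist_holds` (a ground-state sequence to take the
Benjamini–Schramm limit of) and `LennardJonesMinimalDistance_holds` (hard core `1/3`), with
`tendsto_nhds_unique` identifying `E_P[h] = e*` and `ciInf_le` for attainment; same argument as
the route's deciding theorem `closes`. [folklore] -/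
theorem palmUnimodularRigidity_assembly_proof :
    Summit.AtomisticToContinuum.Crystallization.Theses.PalmUnimodularRigidity.Assembly := by
  unfold Summit.AtomisticToContinuum.Crystallization.Theses.PalmUnimodularRigidity.Assembly
  intro hShells hChart hSelect hGlue hBS hHinge hCharged hLim hBdd
  -- the three cruxes and their glue give the target X = PalmRigidity
  have hPalm :
      Summit.AtomisticToContinuum.Crystallization.Theses.PalmUnimodularRigidity.PalmRigidity :=
    hGlue hShells hChart hSelect
  change Literature.MathematicalPhysics.StatisticalMechanics.HasPeriodicGroundStateEnergy
      Literature.MathematicalPhysics.StatisticalMechanics.lennardJones 3 ∧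
    Literature.MathematicalPhysics.StatisticalMechanics.IsCrystallizing
      Literature.MathematicalPhysics.StatisticalMechanics.lennardJones 3
  refine ⟨?_, ?_⟩
  · -- conjunct (i): the periodic minimum is attained (by relaxed HCP) and E(N)/N converges to it
    choose x hx using
      Literature.MathematicalPhysics.StatisticalMechanics.LennardJonesGroundStatesExist_holds
    obtain ⟨φ, hφ, δ, hδ, P, hP, hcore, hstat, hE, -⟩ := hBS x hx
    have h1 : Tendsto (fun j : ℕ =>
        Literature.MathematicalPhysics.StatisticalMechanics.groundStateEnergy
          Literature.MathematicalPhysics.StatisticalMechanics.lennardJones 3 (φ j) / (φ j : ℝ))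
        atTop (𝓝 (⨅ Q : Literature.MathematicalPhysics.StatisticalMechanics.PeriodicConfiguration 3,
          Q.energyPerParticle Literature.MathematicalPhysics.StatisticalMechanics.lennardJones)) :=
      hLim.comp hφ.tendsto_atTop
    -- E_P[h] = e*: the Benjamini–Schramm limit is a minimising point-stationary hard-core law
    have hEq := tendsto_nhds_unique hE h1
    haveI := hP
    -- P is a probability measure, so "P-a.e. rotated relaxed HCP" yields one sample
    obtain ⟨μ, a, h, ha, hh, -, -, -, -, A, hAe, -⟩ :=
      (hPalm δ hδ P hP hcore hstat hEq.le).exists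
    refine ⟨Literature.MathematicalPhysics.StatisticalMechanics.hcpPeriodicConfiguration ha hh,
      ⟨⟨_, rfl⟩, ?_⟩, ?_⟩
    · rintro _ ⟨Q, rfl⟩
      rw [hAe]
      exact ciInf_le hBdd Q
    · rw [hAe]
      exact hLim
  · -- conjunct (ii): the shared finite-N hinge and the proved minimal-distance fact
    exact hCharged (hHinge hPalm hBS hLim)
      Literature.MathematicalPhysics.StatisticalMechanics.LennardJonesMinimalDistance_holds

end Summit.AtomisticToContinuum.Crystallization.Theorems
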